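import Summits.Ventures.PercRepro.C026ThreeState

/-!
# Bit-planes for the 6-vertex gadget, IV: cells as fibres of the digit pattern (p5, gen 13)

The digit of a class (absent / present / mixed), the representative `rep`, and `mem_expand_iff`: the cell
of a valid representative is the set of states with its digits.
-/

namespace PercRepro

namespace MultiGraph
open PairModel Plane6

/-! ### VI. Cells as fibres of the digit pattern -/

/-- The digit of class `i` in the state `t`: `0` absent, `1` present (open or closed), `2` mixed. -/
def dig (i t : ℕ) : ℕ :=
  if t.testBit i then (if t.testBit (12 + i) then 2 else 1) else (if t.testBit (12 + i) then 1 else 0)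

/-- Two states are in the same cell: the same digit in every class. -/
def SameCell (t u : ℕ) : Prop := ∀ i < 12, dig i t = dig i u

/-- The representative of the cell of `t`: open where present, mixed where mixed. -/
def rep (t : ℕ) : ℕ := 2 ^ 12 * maskOf 12 (fun i => decide (dig i t = 2)) + maskOf 12 (fun i => decide (1 ≤ dig i t))

/-- Bit `i < 12` of the representative: the class is present or mixed. -/
theorem testBit_rep_lo (t : ℕ) {i : ℕ} (hi : i < 12) : (rep t).testBit i = decide (1 ≤ dig i t) := by
  unfold rep
  rw [Nat.testBit_two_pow_mul_add _ (maskOf_lt 12 _)]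
  simp [hi, testBit_maskOf]

/-- Bit `12 + i` of the representative: the class is mixed. -/
theorem testBit_rep_hi (t : ℕ) {i : ℕ} (hi : i < 12) : (rep t).testBit (12 + i) = decide (dig i t = 2) := by
  unfold rep
  rw [Nat.testBit_two_pow_mul_add _ (maskOf_lt 12 _)]
  have h1 : ¬ (12 + i < 12) := by omega
  simp [h1, testBit_maskOf, hi]

/-- The representative is below `NS`. -/
theorem rep_lt (t : ℕ) : rep t < NS := by
  unfold rep NS
  have h1 := maskOf_lt 12 (fun i => decide (dig i t = 2))
  have h2 := maskOf_lt 12 (fun i => decide (1 ≤ dig i t))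
  calc 2 ^ 12 * maskOf 12 (fun i => decide (dig i t = 2)) + maskOf 12 (fun i => decide (1 ≤ dig i t))
      < 2 ^ 12 * maskOf 12 (fun i => decide (dig i t = 2)) + 2 ^ 12 := by omega
    _ = 2 ^ 12 * (maskOf 12 (fun i => decide (dig i t = 2)) + 1) := by ring
    _ ≤ 2 ^ 12 * 2 ^ 12 := Nat.mul_le_mul_left _ (by omega)
    _ = 2 ^ 24 := by norm_num

/-- A digit is at most `2`. -/
theorem dig_le_two (i t : ℕ) : dig i t ≤ 2 := by
  unfold dig; split_ifs <;> omega

/-- The representative has the digits of the state. -/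
theorem dig_rep (t : ℕ) {i : ℕ} (hi : i < 12) : dig i (rep t) = dig i t := by
  unfold dig
  rw [testBit_rep_lo t hi, testBit_rep_hi t hi]
  have := dig_le_two i t
  unfold dig at this ⊢
  split_ifs at this ⊢ <;> simp_all

/-- The representative is a valid position. -/
theorem rep_valid (t : ℕ) : valid.testBit (rep t) = true := by
  rw [testBit_valid (rep_lt t)]
  intro i hi
  rw [testBit_rep_lo t hi, testBit_rep_hi t hi]
  by_cases h : dig i t = 2
  · left; simp [h]
  · right; simp [h]

/-- States of the same cell have the same representative. -/
theorem rep_eq_of_sameCell {t u : ℕ} (h : SameCell t u) : rep t = rep u := by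
  unfold rep
  congr 1
  · congr 1
    apply maskOf_congr
    intro i hi
    rw [h i hi]
  · apply maskOf_congr
    intro i hi
    rw [h i hi]

/-- States with the same representative are in the same cell. -/
theorem sameCell_of_rep_eq {t u : ℕ} (h : rep t = rep u) : SameCell t u := by
  intro i hi
  rw [← dig_rep t hi, ← dig_rep u hi, h]

/-- A valid state is its own representative. -/
theorem rep_self {s : ℕ} (hs : s < NS) (hv : valid.testBit s = true) : rep s = s := by
  apply Nat.eq_of_testBit_eq
  intro j
  rw [testBit_valid hs] at hv
  by_cases hj : j < 12
  · rw [testBit_rep_lo s hj]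
    unfold dig
    rcases hv j hj with h | h <;> simp [h] <;> split_ifs <;> simp_all
  · by_cases hj' : j < 24
    · obtain ⟨i, rfl⟩ : ∃ i, j = 12 + i := ⟨j - 12, by omega⟩
      have hi : i < 12 := by omega
      rw [testBit_rep_hi s hi]
      unfold dig
      rcases hv i hi with h | h
      · simp [h]
      · simp [h]; split_ifs <;> simp
    · have h1 : (rep s).testBit j = false :=
        Nat.testBit_lt_two_pow (lt_of_lt_of_le (rep_lt s) (Nat.pow_le_pow_right (by norm_num) (by omega)))
      have h2 : s.testBit j = false :=
        Nat.testBit_lt_two_pow (lt_of_lt_of_le hs (Nat.pow_le_pow_right (by norm_num) (by omega)))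
      rw [h1, h2]

/-- `flip k` keeps every digit. -/
theorem dig_flip {k s : ℕ} (hk : k < 12) (ho : isOpenCls k s = true) {i : ℕ} (hi : i < 12) :
    dig i (flip k s) = dig i s := by
  unfold dig
  rw [testBit_flip hk ho i, testBit_flip hk ho (12 + i)]
  have h1 : ¬ (12 + i = k) := by omega
  simp only [h1, if_false]
  by_cases hik : i = k
  · subst hik
    simp only [if_true]
    simp only [isOpenCls, Bool.and_eq_true, Bool.not_eq_true'] at ho
    have : ¬ (12 + i = 12 + i) = False := by simp
    simp [ho.1, ho.2]
  · have h3 : ¬ (i = 12 + k) := by omega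
    simp [hik, h3]

/-- Members of a cell have the digits of the representative (classes below `k` through the flips,
classes at or above `k` by agreement). -/
theorem dig_of_mem_expand {k : ℕ} (hk : k ≤ 12) {s t : ℕ} (ht : t ∈ expand k s) {i : ℕ} (hi : i < 12) :
    dig i t = dig i s := by
  induction k generalizing t with
  | zero => simp [expand] at ht; subst ht; rfl
  | succ k ih =>
    have hk' : k ≤ 12 := by omega
    simp only [expand] at ht
    split_ifs at ht with ho
    · rw [Finset.mem_union, Finset.mem_image] at ht
      rcases ht with ht | ⟨u, hu, rfl⟩
      · exact ih hk' ht
      · have huo : isOpenCls k u = true := by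
          simp only [isOpenCls, Bool.and_eq_true, Bool.not_eq_true'] at ho ⊢
          rw [agree_of_mem_expand hk' hu k (by omega), agree_of_mem_expand hk' hu (12 + k) (by omega)]
          exact ho
        rw [dig_flip (by omega) huo hi]
        exact ih hk' hu
    · exact ih hk' ht

/-- Members of a cell of a state below `NS` are below `NS`. -/
theorem lt_NS_of_mem_expand {k : ℕ} (hk : k ≤ 12) {s t : ℕ} (hs : s < NS) (ht : t ∈ expand k s) : t < NS := by
  apply Nat.lt_pow_two_of_testBit
  intro j hj
  rw [agree_of_mem_expand hk ht j (by omega)]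
  exact Nat.testBit_lt_two_pow (lt_of_lt_of_le hs (Nat.pow_le_pow_right (by norm_num) hj))

/-- The cell of a valid representative contains every state with its digits. -/
theorem mem_expand_of_dig {s : ℕ} (hs : s < NS) (hv : valid.testBit s = true) :
    ∀ k, k ≤ 12 → ∀ u, u < NS →
      (∀ i < k, dig i u = dig i s) →
      (∀ j, ((k ≤ j ∧ j < 12) ∨ 12 + k ≤ j) → u.testBit j = s.testBit j) →
      u ∈ expand k s := by
  intro k
  induction k with
  | zero =>
    intro _ u hu _ hagree
    have : u = s := by
      apply Nat.eq_of_testBit_eq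
      intro j
      by_cases hj : j < 12
      · exact hagree j (Or.inl ⟨by omega, hj⟩)
      · exact hagree j (Or.inr (by omega))
    simp [expand, this]
  | succ k ih =>
    intro hk12 u hu hdig hagree
    have hk : k < 12 := by omega
    have hk' : k ≤ 12 := by omega
    have hvk := (testBit_valid hs).1 hv k hk
    simp only [expand]
    -- the digit of class `k` of `u` is that of `s`
    have hdk := hdig k (by omega)
    by_cases ho : isOpenCls k s = true
    · rw [if_pos ho, Finset.mem_union, Finset.mem_image]
      simp only [isOpenCls, Bool.and_eq_true, Bool.not_eq_true'] at ho
      have hds : dig k s = 1 := by unfold dig; simp [ho.1, ho.2]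
      rw [hds] at hdk
      -- class `k` of `u` is `(1,0)` or `(0,1)`
      by_cases hu1 : u.testBit k = true
      · have hu2 : u.testBit (12 + k) = false := by
          unfold dig at hdk; simpa [hu1] using hdk
        left
        apply ih hk' u hu (fun i hi => hdig i (by omega))
        intro j hj
        rcases hj with ⟨hj1, hj2⟩ | hj
        · rcases Nat.eq_or_lt_of_le hj1 with rfl | hj1'
          · rw [hu1, ho.1]
          · exact hagree j (Or.inl ⟨by omega, hj2⟩)
        · rcases Nat.eq_or_lt_of_le hj with rfl | hj'
          · rw [hu2, ho.2]
          · exact hagree j (Or.inr (by omega))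
      · have hu1' : u.testBit k = false := by simpa using hu1
        have hu2 : u.testBit (12 + k) = true := by
          unfold dig at hdk; simpa [hu1'] using hdk
        right
        refine ⟨u ^^^ (2 ^ k ||| 2 ^ (12 + k)), ?_, ?_⟩
        · have hbits : ∀ j, (u ^^^ (2 ^ k ||| 2 ^ (12 + k))).testBit j =
              if j = k then true else if j = 12 + k then false else u.testBit j := by
            intro j
            rw [Nat.testBit_xor, Nat.testBit_or, Nat.testBit_two_pow, Nat.testBit_two_pow]
            by_cases hjk : j = k
            · subst hjk; simp [hu1']
            · by_cases hjk' : j = 12 + k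
              · subst hjk'; simp [hu2]
              · have h1 : ¬ (k = j) := fun h => hjk h.symm
                have h2 : ¬ (12 + k = j) := fun h => hjk' h.symm
                simp [hjk, hjk', h1, h2]
          apply ih hk' _ ?_ ?_ ?_
          · apply Nat.lt_pow_two_of_testBit
            intro j hj
            rw [hbits]
            have h1 : ¬ (j = k) := by omega
            have h2 : ¬ (j = 12 + k) := by omega
            simp only [h1, h2, if_false]
            exact Nat.testBit_lt_two_pow (lt_of_lt_of_le hu (Nat.pow_le_pow_right (by norm_num) hj))
          · intro i hi
            rw [← hdig i (by omega)]
            unfold dig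
            rw [hbits, hbits]
            have h1 : ¬ (i = k) := by omega
            have h2 : ¬ (12 + i = k) := by omega
            have h3 : ¬ (i = 12 + k) := by omega
            simp [h1, h2, h3]
          · intro j hj
            rw [hbits]
            by_cases hjk : j = k
            · subst hjk; simp [ho.1]
            · by_cases hjk' : j = 12 + k
              · subst hjk'; simp [ho.2]
              · simp only [hjk, hjk', if_false]
                rcases hj with ⟨hj1, hj2⟩ | hj
                · exact hagree j (Or.inl ⟨by omega, hj2⟩)
                · exact hagree j (Or.inr (by omega))
        · -- `flip k` of the toggled state is `u`
          apply Nat.eq_of_testBit_eq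
          intro j
          have hopen : isOpenCls k (u ^^^ (2 ^ k ||| 2 ^ (12 + k))) = true := by
            simp only [isOpenCls, Bool.and_eq_true, Bool.not_eq_true']
            rw [Nat.testBit_xor, Nat.testBit_or, Nat.testBit_two_pow, Nat.testBit_two_pow,
              Nat.testBit_xor, Nat.testBit_or, Nat.testBit_two_pow, Nat.testBit_two_pow]
            simp [hu1', hu2]
          rw [testBit_flip hk hopen j]
          by_cases hjk : j = k
          · subst hjk; simp [hu1']
          · by_cases hjk' : j = 12 + k
            · subst hjk'; simp [hu2]
            · simp only [hjk, hjk', if_false]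
              rw [Nat.testBit_xor, Nat.testBit_or, Nat.testBit_two_pow, Nat.testBit_two_pow]
              have h1 : ¬ (k = j) := fun h => hjk h.symm
              have h2 : ¬ (12 + k = j) := fun h => hjk' h.symm
              simp [h1, h2]
    · rw [if_neg ho]
      -- class `k` of `s` is absent or mixed; `u` agrees on it
      have hsk : s.testBit k = s.testBit (12 + k) := by
        simp only [isOpenCls, Bool.and_eq_true, Bool.not_eq_true', not_and] at ho
        rcases Bool.eq_false_or_eq_true (s.testBit k) with h1 | h1 <;>
          rcases Bool.eq_false_or_eq_true (s.testBit (12 + k)) with h2 | h2 <;> simp_all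
      apply ih hk' u hu (fun i hi => hdig i (by omega))
      intro j hj
      have key : u.testBit k = s.testBit k ∧ u.testBit (12 + k) = s.testBit (12 + k) := by
        unfold dig at hdk
        rw [← hsk] at hdk
        rcases Bool.eq_false_or_eq_true (s.testBit k) with h | h <;>
          rcases Bool.eq_false_or_eq_true (u.testBit k) with h1 | h1 <;>
          rcases Bool.eq_false_or_eq_true (u.testBit (12 + k)) with h2 | h2 <;>
          simp [h, h1, h2] at hdk ⊢ <;> rw [← hsk] <;> simp [h]
      rcases hj with ⟨hj1, hj2⟩ | hj
      · rcases Nat.eq_or_lt_of_le hj1 with rfl | hj1'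
        · exact key.1
        · exact hagree j (Or.inl ⟨by omega, hj2⟩)
      · rcases Nat.eq_or_lt_of_le hj with rfl | hj'
        · exact key.2
        · exact hagree j (Or.inr (by omega))

/-- **The cell of a valid representative is the set of states with its digits.** -/
theorem mem_expand_iff {s : ℕ} (hs : s < NS) (hv : valid.testBit s = true) (u : ℕ) :
    u ∈ expand 12 s ↔ u < NS ∧ SameCell u s := by
  constructor
  · intro hu
    exact ⟨lt_NS_of_mem_expand le_rfl hs hu, fun i hi => dig_of_mem_expand le_rfl hu hi⟩
  · rintro ⟨hu, hc⟩
    apply mem_expand_of_dig hs hv 12 le_rfl u hu hc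
    intro j hj
    have hj' : 24 ≤ j := by omega
    rw [Nat.testBit_lt_two_pow (lt_of_lt_of_le hu (Nat.pow_le_pow_right (by norm_num) hj')),
      Nat.testBit_lt_two_pow (lt_of_lt_of_le hs (Nat.pow_le_pow_right (by norm_num) hj'))]


end MultiGraph

end PercRepro
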